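/-
Copyright (c) 2026. Released under Apache 2.0 license.
Literature formalization: the relation bound of PSLQ (Ferguson–Bailey–Arno 1999, Theorem 1), real case.
-/
import Mathlib
import HarnessLib

/-!
# The PSLQ relation bound (Ferguson–Bailey–Arno 1999, Theorem 1)

Topic `Literature/NumberTheory/DiophantineApproximation`. H. R. P. Ferguson, D. H. Bailey, S. Arno,
*Analysis of PSLQ, an integer relation finding algorithm*, Math. Comp. 68 (1999), no. 225, 351–369
[FergusonBaileyArno1999]: Theorem 1 (p. 354) together with its proof (p. 355), in the real case
`K = ℝ`, `O(K) = ℤ`.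

An integer relation for `x ∈ ℝⁿ` is a vector `0 ≠ m ∈ ℤⁿ` with `∑ᵢ mᵢ xᵢ = 0`, and `M_x` is the least
Euclidean norm of one (Definition 1). With `H_x` the `n × (n − 1)` lower-trapezoidal matrix of
Definition 2 (`H_xᵀ H_x = I_{n−1}`, `x H_x = 0`: Lemma 1) and `P_x = H_x H_xᵀ = Iₙ − xᵀ x` for `|x| = 1`
(Lemma 2), Theorem 1 reads, verbatim: *"Let `x ≠ 0 ∈ Kⁿ`. Suppose that for any relation `m` of `x` and
for any matrix `A ∈ GL(n, O(K))` there exists a unitary matrix `Q ∈ U(n − 1)` such that `H = A H_x Q` is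
lower trapezoidal and all of the diagonal elements of `H` satisfy `h_{j,j} ≠ 0`. Then
`1 / max_{1 ≤ j ≤ n−1} |h_{j,j}| = min_{1 ≤ j ≤ n−1} 1 / |h_{j,j}| ≤ M_x`."* The paper's *Comment on
Theorem 1*: the inequality "offers an increasing lower bound on the size of any possible relation.
Theorem 1 can be used with any algorithm that produces any `GL(n, O(K))` matrices." This is the
EXCLUSION BOUND that integer-relation software reports ("no integer relation of Euclidean norm below
`1 / max_j |h_{j,j}|`").

## What is formalised, and in what generality

The published proof (p. 355) uses exactly four things: (a) `A m ≠ 0` is an INTEGER vector, so its first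
non-zero entry has absolute value `≥ 1`; (b) `P_x m = m` (Lemma 2 (vi)); (c) the factorisation
`A P_x = (A H_x Q) (Qᵀ H_xᵀ) = H · R`, `H` lower trapezoidal, the rows of `R = Qᵀ H_xᵀ` unit vectors, so
`|(R m)_j| ≤ |m|`; (d) a descent down the rows of the trapezoidal factor: at the least `j` with
`(A m)_j ≠ 0` one gets `(A m)_j = h_{j,j} (R m)_j`, whence `1 ≤ |h_{j,j}| · |m|`.

* `exists_one_le_abs_diag_mul_abs` — step (d) as a stand-alone statement about real lower-triangular
  matrices: if `L w` is a non-zero integer vector then some diagonal entry `L j j ≠ 0` has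
  `1 ≤ |L j j| · |w j|`.
* `FergusonBaileyArno1999_theorem1` — Theorem 1 in the factored form (a)–(c): for every integer relation
  `m` of `x`, every integer matrix `A` with `det A ≠ 0`, every real matrix `P` fixing `x^⊥` pointwise and
  every factorisation `A P = L R` with `L` lower triangular and `|(R m)_j| ≤ M` for all `j`, some diagonal
  entry `L j j ≠ 0` satisfies `1 ≤ |L j j| · M`.
* (private helper `abs_mulVec_le_sqrt_sum_sq` — Cauchy–Schwarz: rows of Euclidean norm `≤ 1` give
  `|(R m)_j| ≤ |m|`.)
* `FergusonBaileyArno1999_relationNorm_ge` — the printed conclusion: `1 / D ≤ |m|` (Euclidean norm) for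
  any `D` dominating every `|L j j|`, in particular `D = max_j |h_{j,j}|`.
* `proj_fixes_orthogonal` — how hypothesis (b) is met: `Iₙ − c · xᵀ x` fixes `x^⊥` pointwise (Lemma 2
  (ii) ⇒ (v), (vi); `c = 1` for a unit vector `x`).

The paper's setting is the instance `P = P_x`, `L = (A H_x Q | 0)` (the `n × (n−1)` trapezoidal matrix `H`
padded by a zero column; a zero diagonal entry of `L` is allowed here exactly when its whole column
vanishes, which covers the padding), `R = (Qᵀ H_xᵀ ; 0)`. The factored statement is slightly MORE
GENERAL than the printed one in three inessential respects already covered by the printed proof: `A`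
need only be a NON-SINGULAR INTEGER matrix (unimodularity is not used), the rows of `R` need only have
Euclidean norm `≤ 1`, and zero columns of `L` are permitted.

Deliberately NOT here: the matrix `H_x` itself (Definition 2, Lemma 1), Hermite reduction and the PSLQ
iteration (Definitions 3–5), the termination and norm bounds of Theorems 2–3, the complex and quaternion
cases. No new definitions are introduced (an integer relation is spelled out as `m ≠ 0 ∧ ∑ mᵢ xᵢ = 0`).

USE: the theorem behind EXCLUSION certificates of integer-relation searches — after any number of exact
(or validated) PSLQ / LLL-type steps producing an integer matrix `A` and the current lower-trapezoidal
`H = A H_x Q`, every integer relation of `x` has Euclidean norm at least `1 / max_j |h_{j,j}|`.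

## References

* [FergusonBaileyArno1999] H. R. P. Ferguson, D. H. Bailey, S. Arno, Analysis of PSLQ, an integer
  relation finding algorithm, Math. Comp. 68 (1999) 351–369: Definitions 1–2, Lemmas 1–2, Theorem 1 and
  its proof (pp. 353–355). doi:10.1090/S0025-5718-99-00995-3
-/

namespace Literature.NumberTheory.DiophantineApproximation

open Matrix Finset

variable {n : ℕ}

/-- **Descent down a lower-triangular factor** — the combinatorial core of the proof of
[FergusonBaileyArno1999] Theorem 1 (p. 355: "Let `j` be the least `j` for which `A_j m ≠ 0` … With this
least choice of `j`, then, `A_j m = h_{j,j} Q_j m`. Therefore … `1 ≤ |A_j m| ≤ |h_{j,j}| |m|`").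
If `L` is a real lower-triangular `n × n` matrix in which a vanishing diagonal entry occurs only in a
vanishing column, and `L w` is a NON-ZERO vector with INTEGER entries `z`, then some diagonal entry
`L j j ≠ 0` satisfies `1 ≤ |L j j| · |w j|`.
[cite: FergusonBaileyArno1999, Theorem 1 (proof, p. 355)] -/
theorem exists_one_le_abs_diag_mul_abs (L : Matrix (Fin n) (Fin n) ℝ) (w : Fin n → ℝ) (z : Fin n → ℤ)
    (hL : ∀ i k : Fin n, i < k → L i k = 0) (hcol : ∀ k : Fin n, L k k = 0 → ∀ i, L i k = 0)
    (hu : L *ᵥ w = fun i => (z i : ℝ)) (hz : z ≠ 0) :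
    ∃ j : Fin n, L j j ≠ 0 ∧ 1 ≤ |L j j| * |w j| := by
  classical
  -- the support of `z` is non-empty; `j` is its least element
  have hS : (univ.filter fun i => z i ≠ 0).Nonempty := by
    by_contra h
    apply hz
    funext i
    by_contra hi
    exact h ⟨i, by simpa using hi⟩
  set j := (univ.filter fun i => z i ≠ 0).min' hS with hj
  have hzj : z j ≠ 0 := by
    have hmem := min'_mem _ hS
    simpa using hmem
  have hmin : ∀ k : Fin n, k < j → z k = 0 := by
    intro k hk
    by_contra hk0
    have hle : j ≤ k := min'_le _ _ (by simpa using hk0)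
    exact absurd hk (not_lt.mpr hle)
  -- the entries of `L *ᵥ w`
  have hrow : ∀ i, ∑ l, L i l * w l = (z i : ℝ) := by
    intro i
    have hi := congrFun hu i
    simpa [Matrix.mulVec, dotProduct] using hi
  -- descent: strictly below `j`, every product `L i k * w k` vanishes
  have hdesc : ∀ d : ℕ, ∀ k : Fin n, (k : ℕ) < d → k < j → ∀ i, L i k * w k = 0 := by
    intro d
    induction d with
    | zero => intro k hk; exact absurd hk (Nat.not_lt_zero _)
    | succ d ih =>
      intro k hkd hkj i
      have hsum : ∑ l, L k l * w l = L k k * w k := by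
        refine Finset.sum_eq_single k (fun l _ hl => ?_) (by simp)
        rcases lt_or_gt_of_ne hl with hlk | hlk
        · have hlk' : (l : ℕ) < (k : ℕ) := Fin.lt_def.mp hlk
          exact ih l (by omega) (hlk.trans hkj) k
        · rw [hL k l hlk, zero_mul]
      have hkk : L k k * w k = 0 := by
        rw [← hsum, hrow k, hmin k hkj]
        simp
      rcases mul_eq_zero.mp hkk with h0 | h0
      · rw [hcol k h0 i, zero_mul]
      · rw [h0, mul_zero]
  -- the `j`-th row: `z j = L j j * w j`
  have hsumj : ∑ l, L j l * w l = L j j * w j := by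
    refine Finset.sum_eq_single j (fun l _ hl => ?_) (by simp)
    rcases lt_or_gt_of_ne hl with hlj | hlj
    · exact hdesc ((l : ℕ) + 1) l (by omega) hlj j
    · rw [hL j l hlj, zero_mul]
  have hzj' : (1 : ℝ) ≤ |(z j : ℝ)| := by
    have h1 : (1 : ℤ) ≤ |z j| := Int.one_le_abs hzj
    exact_mod_cast h1
  have key : (1 : ℝ) ≤ |L j j| * |w j| := by
    rw [← abs_mul, ← hsumj, hrow j]
    exact hzj'
  refine ⟨j, ?_, key⟩
  intro h0
  rw [h0, abs_zero, zero_mul] at key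
  exact absurd key (by norm_num)

/-- **Theorem 1 of [FergusonBaileyArno1999], factored form (real case).** Let `m` be an integer relation
for `x ∈ ℝⁿ` (`m ≠ 0`, `∑ᵢ mᵢ xᵢ = 0`), `A` an integer `n × n` matrix with `det A ≠ 0`, `P` a real matrix
fixing every vector orthogonal to `x` (the paper's `P_x`, Lemma 2 (vi)), and `A P = L R` with `L` lower
triangular (a zero diagonal entry only in a zero column) and `|(R m)_j| ≤ M` for every row `j` (the
paper: `L = (A H_x Q | 0) = (H | 0)`, `R = (Qᵀ H_xᵀ ; 0)` with unit rows, `M = |m|`). Then some diagonal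
entry `L j j ≠ 0` — a diagonal entry `h_{j,j}` of `H` — satisfies `1 ≤ |L j j| · M`; in the words of the
proof, "`1 ≤ |A_j m| ≤ |h_{j,j} Q_{H,j} m| ≤ |h_{j,j}| |m|`".
[cite: FergusonBaileyArno1999, Theorem 1] -/
theorem FergusonBaileyArno1999_theorem1 (x : Fin n → ℝ) (m : Fin n → ℤ) (hm : m ≠ 0)
    (hrel : ∑ i, (m i : ℝ) * x i = 0)
    (A : Matrix (Fin n) (Fin n) ℤ) (hA : A.det ≠ 0) (P L R : Matrix (Fin n) (Fin n) ℝ)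
    (hP : ∀ v : Fin n → ℝ, ∑ i, v i * x i = 0 → P *ᵥ v = v)
    (hfac : A.map (Int.cast : ℤ → ℝ) * P = L * R)
    (hL : ∀ i k : Fin n, i < k → L i k = 0) (hcol : ∀ k : Fin n, L k k = 0 → ∀ i, L i k = 0)
    (M : ℝ) (hR : ∀ j, |(R *ᵥ fun i => (m i : ℝ)) j| ≤ M) :
    ∃ j : Fin n, L j j ≠ 0 ∧ 1 ≤ |L j j| * M := by
  set mR : Fin n → ℝ := fun i => (m i : ℝ) with hmR
  -- (a) `A m` is a non-zero integer vector
  have hz : A *ᵥ m ≠ 0 := fun h => hm (Matrix.eq_zero_of_mulVec_eq_zero hA h)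
  have hAm : A.map (Int.cast : ℤ → ℝ) *ᵥ mR = fun i => ((A *ᵥ m) i : ℝ) := by
    funext i
    simp [Matrix.mulVec, dotProduct, Matrix.map_apply, hmR, Int.cast_sum, Int.cast_mul]
  -- (b) + (c): `A m = A (P m) = (A P) m = (L R) m = L (R m)`
  have hPm : P *ᵥ mR = mR := hP mR (by simpa [hmR] using hrel)
  have hu : L *ᵥ (R *ᵥ mR) = fun i => ((A *ᵥ m) i : ℝ) := by
    rw [Matrix.mulVec_mulVec, ← hfac, ← Matrix.mulVec_mulVec, hPm, hAm]
  -- (d) descent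
  obtain ⟨j, hj0, hj⟩ := exists_one_le_abs_diag_mul_abs L (R *ᵥ mR) (A *ᵥ m) hL hcol hu hz
  exact ⟨j, hj0, hj.trans (mul_le_mul_of_nonneg_left (hR j) (abs_nonneg _))⟩

/-- Cauchy–Schwarz for one row: if every row of the real matrix `R` has Euclidean norm at most `1`
(`∑ₖ R j k ^ 2 ≤ 1`), then `|(R v)_j| ≤ (∑ₖ v k ^ 2)^{1/2}` — step (c) of the proof of
[FergusonBaileyArno1999] Theorem 1 ("because `Q_{H,j}` is a unit vector"). [folklore] -/
private theorem abs_mulVec_le_sqrt_sum_sq (R : Matrix (Fin n) (Fin n) ℝ) (hR : ∀ j, ∑ k, R j k ^ 2 ≤ 1)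
    (v : Fin n → ℝ) (j : Fin n) : |(R *ᵥ v) j| ≤ Real.sqrt (∑ k, v k ^ 2) := by
  have hv : 0 ≤ ∑ k, v k ^ 2 := Finset.sum_nonneg fun k _ => sq_nonneg (v k)
  have hcs : (∑ k, R j k * v k) ^ 2 ≤ (∑ k, R j k ^ 2) * ∑ k, v k ^ 2 :=
    Finset.sum_mul_sq_le_sq_mul_sq _ _ _
  have h2 : (∑ k, R j k * v k) ^ 2 ≤ ∑ k, v k ^ 2 :=
    hcs.trans ((mul_le_mul_of_nonneg_right (hR j) hv).trans_eq (one_mul _))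
  have habs : |(R *ᵥ v) j| = Real.sqrt ((∑ k, R j k * v k) ^ 2) := by
    rw [Real.sqrt_sq_eq_abs]
    simp [Matrix.mulVec, dotProduct]
  rw [habs]
  exact Real.sqrt_le_sqrt h2

/-- **Theorem 1 of [FergusonBaileyArno1999] — the relation bound `1 / max_j |h_{j,j}| ≤ M_x` (real
case).** In the setting of `FergusonBaileyArno1999_theorem1` with the rows of `R` of Euclidean norm at
most `1` (in the paper they are orthonormal: `R = Qᵀ H_xᵀ`), every integer relation `m` of `x` has
Euclidean norm `|m| = (∑ₖ m k ^ 2)^{1/2} ≥ 1 / D` for any real `D` with `|L j j| ≤ D` for all `j` — in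
particular for `D = max_j |h_{j,j}|`, the printed statement. (Some `|L j j| > 0`, so `D > 0`.)
[cite: FergusonBaileyArno1999, Theorem 1] -/
theorem FergusonBaileyArno1999_relationNorm_ge (x : Fin n → ℝ) (m : Fin n → ℤ) (hm : m ≠ 0)
    (hrel : ∑ i, (m i : ℝ) * x i = 0)
    (A : Matrix (Fin n) (Fin n) ℤ) (hA : A.det ≠ 0) (P L R : Matrix (Fin n) (Fin n) ℝ)
    (hP : ∀ v : Fin n → ℝ, ∑ i, v i * x i = 0 → P *ᵥ v = v)
    (hfac : A.map (Int.cast : ℤ → ℝ) * P = L * R)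
    (hL : ∀ i k : Fin n, i < k → L i k = 0) (hcol : ∀ k : Fin n, L k k = 0 → ∀ i, L i k = 0)
    (hR : ∀ j, ∑ k, R j k ^ 2 ≤ 1) (D : ℝ) (hD : ∀ j, |L j j| ≤ D) :
    1 / D ≤ Real.sqrt (∑ k, (m k : ℝ) ^ 2) := by
  obtain ⟨j, hj0, hj⟩ := FergusonBaileyArno1999_theorem1 x m hm hrel A hA P L R hP hfac hL hcol
    (Real.sqrt (∑ k, (m k : ℝ) ^ 2)) (fun j => abs_mulVec_le_sqrt_sum_sq R hR _ j)
  have hDpos : 0 < D := lt_of_lt_of_le (abs_pos.mpr hj0) (hD j)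
  have h1 : 1 ≤ D * Real.sqrt (∑ k, (m k : ℝ) ^ 2) :=
    hj.trans (mul_le_mul_of_nonneg_right (hD j) (Real.sqrt_nonneg _))
  have hinv : 0 ≤ 1 / D := by positivity
  have hDne : D ≠ 0 := hDpos.ne'
  calc 1 / D = (1 / D) * 1 := (mul_one _).symm
    _ ≤ (1 / D) * (D * Real.sqrt (∑ k, (m k : ℝ) ^ 2)) := mul_le_mul_of_nonneg_left h1 hinv
    _ = Real.sqrt (∑ k, (m k : ℝ) ^ 2) := by field_simp

/-- **Lemma 2 (ii) ⇒ (v), (vi) of [FergusonBaileyArno1999]** — how hypothesis (b) of Theorem 1 is met: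
the matrix `Iₙ − c · xᵀ x` fixes every vector `v` orthogonal to `x` (`∑ᵢ vᵢ xᵢ = 0`); for a unit vector
`x` and `c = 1` this is `P_x = Iₙ − xᵀ x` (Lemma 2 (ii)) and the conclusion is Lemma 2 (v) / (vi)
("`P_x mᵀ = mᵀ` for any relation `m`"). [cite: FergusonBaileyArno1999, Lemma 2] -/
theorem proj_fixes_orthogonal (x : Fin n → ℝ) (c : ℝ) (v : Fin n → ℝ) (hv : ∑ i, v i * x i = 0) :
    (1 - c • Matrix.vecMulVec x x) *ᵥ v = v := by
  have hv' : ∑ j, x j * v j = 0 := by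
    simpa [mul_comm] using hv
  have hker : Matrix.vecMulVec x x *ᵥ v = 0 := by
    funext i
    simp only [Matrix.mulVec, dotProduct, Matrix.vecMulVec_apply, Pi.zero_apply]
    calc ∑ j, x i * x j * v j = x i * ∑ j, x j * v j := by
          rw [Finset.mul_sum]
          exact Finset.sum_congr rfl fun j _ => by ring
      _ = 0 := by rw [hv', mul_zero]
  rw [Matrix.sub_mulVec, Matrix.one_mulVec, Matrix.smul_mulVec, hker, smul_zero, sub_zero]

end Literature.NumberTheory.DiophantineApproximation
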